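import Summits.BirchSwinnertonDyer.Rank1Residual.X11b.BDPRouteCyclotomicLeverClass
import Summits.BirchSwinnertonDyer.Rank1Residual.X11b.BDPRouteEndState
import Summits.BirchSwinnertonDyer.Rank1Residual.X11b.BDPRouteOpenInputOdd
import HarnessLib

/-!
# Class X11b, route p2: the one-sided cyclotomic lever, part 3 — the ¬(ram) ATOM SETTLED modulo ONE
# `p`-adic height per pair, and the route's statement of record WITHOUT (T2α′), (T2♯-ℝ), (T3)
# (cell `b2b-bsdres`, sub-cell `multr1-p2`, gen 21)

HONEST FRAMING (verbatim, cell `b2b-bsdres`, run/shared/lean/b2b/bsd-rank1-residual/): the goal of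
the cell is to DELETE the COMBINATION-SHAPED residual classes for ALL analytic-rank `≤ 1` curves
over `ℚ` — "full BSD formula for every rank `≤ 1` curve in class `C`" assembled STRICTLY from
published theorems — so that the rank-`≤ 1` remainder becomes exactly the CONSTRUCTION-SHAPED
classes, which are TYPED (missing-input Props), NOT attempted; this is not "finishing BSD".
Research route `p2` for class X11b (`ClassX11b W p := r_an = 1 ∧ p ≠ 2 ∧ mult(p) ∧ irr(p)`,
`Partition/Rows.lean`); no claim beyond the stated class and loci; nothing booked; X11b stays
CONSTRUCTION-SHAPED. THEOREMS ONLY (no definition, no named fact, no `sorry`). Every theorem is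
CONDITIONAL on the published named facts it lists, on THE open input of the route where stated, and
on the per-pair input `SchneiderConjecture Dh` / `ClassClosure.RegulatorNonvanishingAt W p`
(`Reg_p(E) ≠ 0` for THE canonical `p`-adic height: a finite `p`-adic computation per pair —
class-wide it is Schneider's conjecture, OPEN; barrier file
`Literature/Barriers/BirchSwinnertonDyer/PAdicHeightNondegeneracyProofs.lean`).

## What this file does (part 3 of 3; parts 1–2 = `X11b/BDPRouteCyclotomicLever{,Class}.lean`)

* §3 `P2.bsdp_of_surj_of_regulatorNonvanishing` — `BSD(E,p)` at every X11b pair with `p ≥ 5` and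
  `ρ̄_{E,p}` onto: lower half from THE open input at the pair (`P2.missingLowerBoundAt_of_openInputAt`,
  gen 18), upper half from the one-sided lever (part 2) + `ClassClosure.RegulatorNonvanishingAt W p`
  (+ a second multiplicative prime if split at `p`, Disegni's (∗)); in particular on the ¬(ram) atom
  A3 (`P2.bsdp_of_not_ram_of_regulatorNonvanishing`; 112 175 ‖ 6 637 class-wide pairs at `p ≥ 5`),
  where the route's former input (T3) had NO source. `P2.bsdp_of_surj_nonsplit_odd_of_schneider` —
  ANY odd prime, non-split `p` (`p = 3`: the ¬(ram) atom at `3`, 10 467 classes, census3/).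
* §4 `P2.bsdp_of_onTree_cyclotomic` — STATEMENT OF RECORD: `∀ (E,p) ∈` X11b, `p ≥ 5 → BSD(E,p)`
  from published named facts, THE open input, (REG) `RegulatorNonvanishingAt` per pair, (T2∗) the
  Euler-system half on "split at `p`, no other multiplicative prime" (Disegni's (∗) fails; such pairs
  are ¬(ram)), (T4′) the corner — (T2α′), (T2♯-ℝ), (T3) GONE. `bsdp_of_classX11b_five_twoRoads` —
  with Skinner 2016 Thm. A on the (ram) atom (class-closure lever) the open input is needed ONLY on
  ¬(ram) ∧ surj pairs (4.9 % of the class-wide shape).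
Numbers (class-wide X11b shape, `p ≥ 5`, Cremona `N < 5·10⁵` ‖ `N < 2·10⁴`; multr1-p1's
`census500k/census_all_500k.tsv.gz` columns `img`, `type_at_p`, `n_mult_ne_p`, `Ram`, re-counted by
this seat, `census21/`; data, not claims): 2 267 348 ‖ 70 420 pairs; (ram) 2 155 109 ‖ 63 778;
¬(ram) 112 239 ‖ 6 642, of which surjective 112 175 ‖ 6 637 = NON-SPLIT at `p` 55 539 ‖ 3 208
(reached here) + split with a second multiplicative prime 1 547 ‖ 103 (reached here) + split with
`p` the ONLY multiplicative prime 55 089 ‖ 3 326 (= (T2∗), NOT reached: Disegni's exact formula needs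
(∗); Venerucci's Thm. D is "up to `ℚ^×`"); non-surjective corner 64 ‖ 5. So the lever moves
57 086 ‖ 3 311 ¬(ram) pairs from "no source for the Euler-system half" to "one `p`-adic height per
pair". Labels UNCHANGED; nothing booked; X11b stays CONSTRUCTION-SHAPED.

References: [Wuthrich2014] Thm. 3, Prop. 21; [SteinWuthrich2013] Thm. 6.1, §4.2; [Disegni2020]
Thm. 1, (∗); [Skinner2016PacificMC] Thm. A; [Castella2018] Thm. 2.3, 3.2; [Castella2018Erratum]
(2.4); [JetchevSkinnerWan2017] §7.4.1, Prop. 3.2.1; [Miller2011LMS] Def. 1.1.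
-/

set_option autoImplicit false

noncomputable section

open scoped Classical MatrixGroups ModularForm

open CongruenceSubgroup WeierstrassCurve NumberField IsDedekindDomain Field
open Literature.NumberTheory.EllipticCurves Literature.NumberTheory.EllipticCurves.GreenbergSelmer
  Literature.NumberTheory.EllipticCurves.ModularForms
  Literature.NumberTheory.EllipticCurves.Rank1Residual
  Literature.NumberTheory.EllipticCurves.Rank1Residual.Typed
  Literature.NumberTheory.EllipticCurves.Wuthrich2014
  Literature.NumberTheory.EllipticCurves.SteinWuthrich2013
  Literature.NumberTheory.EllipticCurves.Disegni2020
  Literature.NumberTheory.EllipticCurves.Skinner2016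
  Literature.NumberTheory.EllipticCurves.BalakrishnanEtAl2019
  Literature.NumberTheory.QuadraticFields.Quadratic
  Literature.NumberTheory.Automorphic
  Literature.NumberTheory.GaloisRepresentations Literature.NumberTheory.GaloisCohomology

namespace Summit.BirchSwinnertonDyer.Rank1Residual.X11b

/-! ### §3. Route p2: the ¬(ram) atom (and every surjective pair) from THE open input + the lever -/

section RouteP2

variable (W : WeierstrassCurve ℚ) [W.IsElliptic] [W.IsGloballyMinimal] (p : ℕ) [Fact p.Prime]

/-- **Route p2 × the one-sided lever — `BSD(E,p)` at every X11b pair with `p ≥ 5` and `ρ̄_{E,p}`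
onto, in particular on the ¬(ram) atom A3 (112 175 ‖ 6 637 class-wide pairs, where the route's
only road to the Euler-system half, (T3) = the main-conjecture half of the rank-`0` sister class
X11a, has NO source).** Lower half: `P2.missingLowerBoundAt_of_openInputAt` — the route's published
facts (Gross–Zagier, Kolyvagin, Wuthrich 2014 Prop. 21, GZK, modularity ×2, Hoffstein–Luo, Mazur
1978 Cor. 4.1, Poitou–Tate, local Euler characteristic) and THE open input AT THE PAIR
(`P2OpenInputOnTreeAt W p`). Upper half: `missingUpperBoundAt_of_katoSurj_of_regulatorNonvanishing`
— Kato's divisibility (Wuthrich 2014 Thm. 3), Stein–Wuthrich 2013 Thm. 6.1 ×2 and §4.2 ×2, Disegni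
2020 Thm. 1, GZK, modularity, the per-pair input `ClassClosure.RegulatorNonvanishingAt W p`, and a
second multiplicative prime if `E` is split at `p` (`hstar`). NO (ram), NO Tamagawa hypothesis, ANY
`#Ш_an`. CONDITIONAL on the open input and on the per-pair regulator input; nothing booked; X11b
stays CONSTRUCTION-SHAPED. [cite: Wuthrich2014, Thm. 3 (p. 383), Prop. 21 (p. 400)]
[cite: SteinWuthrich2013, Thm. 6.1 (p. 20), §4.2] [cite: Disegni2020, Thm. 1 (§1.2), (∗)]
[cite: JetchevSkinnerWan2017, §7.4.1 (pp. 30–31)] [cite: Castella2018, Thm. 2.3 (p. 5), Thm. 3.2 (p. 9)]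
[cite: Castella2018Erratum, (2.4) (p. 1)] [cite: Miller2011LMS, Def. 1.1] -/
theorem P2.bsdp_of_surj_of_regulatorNonvanishing
    -- route p2's published inputs
    (hGZ : ∀ (N : ℕ) [NeZero N] (W : WeierstrassCurve ℚ) (K : Type) [Field K] [NumberField K],
      gross_zagier N W K)
    (hKo : ∀ (N : ℕ) [NeZero N] (W : WeierstrassCurve ℚ) (K : Type) [Field K] [NumberField K],
      kolyvagin N W K)
    (hWu : sha_dvd_analyticSha)
    (hGZK : rank_eq_analyticRank_of_analyticRank_le_one) (hmod : hasEntireLFunction_rat)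
    (hnf : exists_isNewformOf) (hHL : HoffsteinLuo1997_exists_twist_L_one_ne_zero)
    (hMaz : mazur_not_dvd_maninConstant_of_odd)
    (hPT : ∀ (K : Type) [Field K] [NumberField K], poitouTate_sum_localTatePairing_eq_zero K)
    (hEP : ∀ (K : Type) [Field K] [NumberField K] (v : HeightOneSpectrum (𝓞 K)),
      localEulerPoincareCharacteristic (v.adicCompletion K))
    -- the lever's published inputs
    (hK : kato_charIdeal_dvd_multiplicative_of_surjective)
    (hJn : thm61_nonsplitMultiplicative) (hJs : thm61_splitMultiplicative)
    (hHn : exists_isMultCanonical) (hHs : exists_isSplitMultCanonical)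
    (hD : thm1_padicBSD_rankOne_multiplicative) (hpar : nonempty_modularParametrizationData)
    -- THE open input, at this pair
    (hA : P2OpenInputOnTreeAt W p)
    -- the per-pair regulator input (THE canonical `p`-adic height is non-degenerate)
    (hReg : ClassClosure.RegulatorNonvanishingAt W p)
    -- the pair: X11b, `p ≥ 5`, surjective; Disegni's (∗) if split at `p`
    (hX : ClassX11b W p) (hp5 : 5 ≤ p) (hsurj : Surj W p)
    (hstar : W.HasSplitMultiplicativeReductionAtPrime p →
      ∃ (m : ℕ) (_ : Fact m.Prime), m ≠ p ∧ W.HasMultiplicativeReductionAtPrime m) :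
    BSDp W p :=
  P2.bsdp_of_surj_of_missingUpperBoundAt_endState W p hGZ hKo hWu hGZK hmod hnf hHL hMaz hPT hEP hA
    (missingUpperBoundAt_of_katoSurj_of_regulatorNonvanishing W p hK hJn hJs hHn hHs hD hGZK hpar hp5
      hX.2.2.1 hX.1 hsurj hstar hReg)
    hX hp5 hsurj

/-- **The ¬(ram) atom, named** (the case the human's brief asks to state: "which `(E, p)` each
route settles"): on X11b ∧ `p ≥ 5` ∧ ¬(ram) ∧ surj, `BSD(E,p)` ⇐ the two routes' published facts +
THE open input at the pair + `RegulatorNonvanishingAt W p` + Disegni's (∗) (`hstar`: automatic at a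
non-split `p`; at a split `p` it asks for a second multiplicative prime — census: of the 112 175 ‖
6 637 ¬(ram) ∧ surj pairs, 55 539 ‖ 3 208 are non-split and 1 547 ‖ 103 split with a second
multiplicative prime (reached), 55 089 ‖ 3 326 are split with `p` the only multiplicative prime (NOT
reached — (T2∗) of §4)). Before this file the whole atom needed the SOURCELESS (T3).
`P2.bsdp_of_surj_of_regulatorNonvanishing` verbatim (¬(ram) is not used by the proof — recorded as
the population of interest). CONDITIONAL; nothing booked.
[cite: Disegni2020, Thm. 1 (§1.2), (∗)] [cite: Miller2011LMS, Def. 1.1] -/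
theorem P2.bsdp_of_not_ram_of_regulatorNonvanishing
    (hGZ : ∀ (N : ℕ) [NeZero N] (W : WeierstrassCurve ℚ) (K : Type) [Field K] [NumberField K],
      gross_zagier N W K)
    (hKo : ∀ (N : ℕ) [NeZero N] (W : WeierstrassCurve ℚ) (K : Type) [Field K] [NumberField K],
      kolyvagin N W K)
    (hWu : sha_dvd_analyticSha)
    (hGZK : rank_eq_analyticRank_of_analyticRank_le_one) (hmod : hasEntireLFunction_rat)
    (hnf : exists_isNewformOf) (hHL : HoffsteinLuo1997_exists_twist_L_one_ne_zero)
    (hMaz : mazur_not_dvd_maninConstant_of_odd)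
    (hPT : ∀ (K : Type) [Field K] [NumberField K], poitouTate_sum_localTatePairing_eq_zero K)
    (hEP : ∀ (K : Type) [Field K] [NumberField K] (v : HeightOneSpectrum (𝓞 K)),
      localEulerPoincareCharacteristic (v.adicCompletion K))
    (hK : kato_charIdeal_dvd_multiplicative_of_surjective)
    (hJn : thm61_nonsplitMultiplicative) (hJs : thm61_splitMultiplicative)
    (hHn : exists_isMultCanonical) (hHs : exists_isSplitMultCanonical)
    (hD : thm1_padicBSD_rankOne_multiplicative) (hpar : nonempty_modularParametrizationData)
    (hA : P2OpenInputOnTreeAt W p) (hReg : ClassClosure.RegulatorNonvanishingAt W p)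
    (hX : ClassX11b W p) (hp5 : 5 ≤ p) (_hnram : ¬ Ram W p) (hsurj : Surj W p)
    (hstar : W.HasSplitMultiplicativeReductionAtPrime p →
      ∃ (m : ℕ) (_ : Fact m.Prime), m ≠ p ∧ W.HasMultiplicativeReductionAtPrime m) :
    BSDp W p :=
  P2.bsdp_of_surj_of_regulatorNonvanishing W p hGZ hKo hWu hGZK hmod hnf hHL hMaz hPT hEP hK hJn hJs
    hHn hHs hD hpar hA hReg hX hp5 hsurj hstar

/-- **The same at ANY ODD prime for a NON-SPLIT `p` — `p = 3` included** (the ¬(ram) atom of X11b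
at `3`: 10 467 classes with `N < 5·10⁵`, census3/; all non-semistable, so the `3`-adic image
hypothesis `hρ` — `ρ̄_{E,3^n}` onto for all `n` — is a per-pair certificate there, not Serre).
Lower half: `P2.missingLowerBoundAt_of_openInputOddAt` from `P2OpenInputOnTreeOddAt W p` [at
`p = 3`: NO source]. Upper half: `missingUpperBoundAt_of_katoSurj_nonsplit_of_schneider`.
CONDITIONAL; nothing booked. [cite: Wuthrich2014, Thm. 3 (p. 383)] [cite: SteinWuthrich2013, Thm. 6.1, §4.2]
[cite: Disegni2020, Thm. 1 (§1.2), Thm. 4 first bullet] [cite: Miller2011LMS, Def. 1.1] -/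
theorem P2.bsdp_of_surj_nonsplit_odd_of_schneider
    (hGZ : ∀ (N : ℕ) [NeZero N] (W : WeierstrassCurve ℚ) (K : Type) [Field K] [NumberField K],
      gross_zagier N W K)
    (hKo : ∀ (N : ℕ) [NeZero N] (W : WeierstrassCurve ℚ) (K : Type) [Field K] [NumberField K],
      kolyvagin N W K)
    (hWu : sha_dvd_analyticSha)
    (hGZK : rank_eq_analyticRank_of_analyticRank_le_one) (hmod : hasEntireLFunction_rat)
    (hnf : exists_isNewformOf) (hHL : HoffsteinLuo1997_exists_twist_L_one_ne_zero)
    (hMaz : mazur_not_dvd_maninConstant_of_odd)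
    (hPT : ∀ (K : Type) [Field K] [NumberField K], poitouTate_sum_localTatePairing_eq_zero K)
    (hEP : ∀ (K : Type) [Field K] [NumberField K] (v : HeightOneSpectrum (𝓞 K)),
      localEulerPoincareCharacteristic (v.adicCompletion K))
    (hK : kato_charIdeal_dvd_multiplicative_of_surjective) (hJn : thm61_nonsplitMultiplicative)
    (hHn : exists_isMultCanonical) (hD : thm1_padicBSD_rankOne_multiplicative)
    (hpar : nonempty_modularParametrizationData)
    (hA : P2OpenInputOnTreeOddAt W p)
    (hX : ClassX11b W p) (hsurj : Surj W p)
    (hρ : ∀ n : ℕ, W.HasSurjectiveModNGaloisRep (p ^ n : ℕ))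
    (hns : ¬ W.HasSplitMultiplicativeReductionAtPrime p)
    (hSch : ∀ (q : ℚ_[p]) (Dh : PAdicHeightData W p), q ≠ 0 → ‖q‖ < 1 → tateJ q = (W.j : ℚ_[p]) →
      IsMultCanonical Dh q → SchneiderConjecture Dh) :
    BSDp W p :=
  Typed.bsdp_of_missingPPartAt W p hGZK (by rw [hX.1])
    (Typed.missingPPartAt_of_lower_of_upper W p
      (P2.missingLowerBoundAt_of_openInputOddAt W p hGZ hKo hWu hGZK hmod hnf hHL hMaz hPT hEP hA hX
        hsurj)
      (missingUpperBoundAt_of_katoSurj_nonsplit_of_schneider W p hK hJn hHn hD hGZK hpar hX.2.1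
        hX.2.2.1 hns hX.1 hρ hSch))

end RouteP2

/-! ### §4. Records -/

/-- **Route p2 — STATEMENT OF RECORD WITH THE CYCLOTOMIC EULER-SYSTEM HALF (gen 21).**
`∀ (E, p) ∈` X11b, `p ≥ 5 → BSD(E, p)` from: route p2's published named facts (Gross–Zagier,
Kolyvagin, Wuthrich 2014 Prop. 21, GZK, modularity ×2, Hoffstein–Luo, Mazur 1978 Cor. 4.1, BDMTV,
Poitou–Tate, local Euler characteristic), the lever's published named facts (Kato's divisibility =
Wuthrich 2014 Thm. 3, Stein–Wuthrich 2013 Thm. 6.1 ×2 and §4.2 ×2, Disegni 2020 Thm. 1, modular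
parametrisation), and the typed inputs
* (T1ᵗ-IMC) `P2OpenInputOnTreeAt` — THE open input at `p ∥ N` [erratum (2.4) ⇐ FW21 Thm. 4.41,
  UNREFEREED], as in every record of the route;
* (REG) `ClassClosure.RegulatorNonvanishingAt W p` at every pair — THE canonical `p`-adic height
  is non-degenerate [per pair: a finite `p`-adic computation; class-wide: Schneider's conjecture,
  OPEN — barrier `PAdicHeightNondegeneracyProofs`];
* (T2∗) the Euler-system half on the pairs SPLIT at `p` with NO OTHER multiplicative prime
  (Disegni's (∗) fails — his exact formula uses Ribet–Takahashi on `X₀^{mp}`; such pairs have no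
  (ram) prime; 55 117 ‖ 3 328 class-wide pairs, 55 089 ‖ 3 326 of them surjective — HALF of the
  ¬(ram) atom, all with `N = p · (additive part)`);
* (T4′) the localised non-surjective corner (`p ∈ {5,7}`, `p ∣ ord_p Δ_min`, ¬(ram); 64 class-wide
  pairs, all at `p = 5`).
GONE with respect to `P2.bsdp_of_onTree_endState` (gen 18): (T2α′), (T2♯-ℝ) the Shimura
displays, (T3) the X11a lower half — and with them the binders Kolyvagin 1990 (index bound), Skinner
2016 Thm. C, Friedberg–Hoffstein ×2. CONDITIONAL; nothing booked; labels UNCHANGED; X11b stays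
CONSTRUCTION-SHAPED. [cite: Wuthrich2014, Thm. 3 (p. 383), Prop. 21 (p. 400)]
[cite: SteinWuthrich2013, Thm. 6.1 (p. 20), §4.2] [cite: Disegni2020, Thm. 1 (§1.2), (∗)]
[cite: Schneider1982PadicHeightI, §1] [cite: Castella2018, Thm. 2.3, Thm. 3.2] [cite: Castella2018Erratum, (2.4)]
[cite: JetchevSkinnerWan2017, §7.4.1, Prop. 3.2.1] [cite: BalakrishnanEtAl2019, §1 Thm. 1.2]
[cite: MilneADT2006, Ch. I, Thm. 4.10(b) and Thm. 2.8] [cite: Miller2011LMS, Def. 1.1] -/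
theorem P2.bsdp_of_onTree_cyclotomic
    -- route p2's published inputs (named facts of the tree)
    (hGZ : ∀ (N : ℕ) [NeZero N] (W : WeierstrassCurve ℚ) (K : Type) [Field K] [NumberField K],
      gross_zagier N W K)
    (hKo : ∀ (N : ℕ) [NeZero N] (W : WeierstrassCurve ℚ) (K : Type) [Field K] [NumberField K],
      kolyvagin N W K)
    (hWu : sha_dvd_analyticSha)
    (hGZK : rank_eq_analyticRank_of_analyticRank_le_one) (hmod : hasEntireLFunction_rat)
    (hnf : exists_isNewformOf) (hHL : HoffsteinLuo1997_exists_twist_L_one_ne_zero)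
    (hMaz : mazur_not_dvd_maninConstant_of_odd)
    (hBDMTV : thm12_not_le_normalizer_splitCartan)
    (hPT : ∀ (K : Type) [Field K] [NumberField K], poitouTate_sum_localTatePairing_eq_zero K)
    (hEP : ∀ (K : Type) [Field K] [NumberField K] (v : HeightOneSpectrum (𝓞 K)),
      localEulerPoincareCharacteristic (v.adicCompletion K))
    -- the lever's published inputs
    (hK : kato_charIdeal_dvd_multiplicative_of_surjective)
    (hJn : thm61_nonsplitMultiplicative) (hJs : thm61_splitMultiplicative)
    (hHn : exists_isMultCanonical) (hHs : exists_isSplitMultCanonical)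
    (hD : thm1_padicBSD_rankOne_multiplicative) (hpar : nonempty_modularParametrizationData)
    -- (T1ᵗ-IMC) THE open input
    (hA : ∀ (W : WeierstrassCurve ℚ) [W.IsElliptic] [W.IsGloballyMinimal] (p : ℕ) [Fact p.Prime],
      P2OpenInputOnTreeAt W p)
    -- (REG) the per-pair regulator input
    (hReg : ∀ (W : WeierstrassCurve ℚ) [W.IsElliptic] [W.IsGloballyMinimal] (p : ℕ) [Fact p.Prime],
      ClassX11b W p → 5 ≤ p → ClassClosure.RegulatorNonvanishingAt W p)
    -- (T2∗) the residue of Disegni's (∗): split at `p`, no other multiplicative prime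
    (hUstar : ∀ (W : WeierstrassCurve ℚ) [W.IsElliptic] [W.IsGloballyMinimal] (p : ℕ)
      [Fact p.Prime], ClassX11b W p → 5 ≤ p → W.HasSplitMultiplicativeReductionAtPrime p →
      (¬ ∃ (m : ℕ) (_ : Fact m.Prime), m ≠ p ∧ W.HasMultiplicativeReductionAtPrime m) →
      Typed.MissingUpperBoundAt W p)
    -- (T4′) the localised non-surjective corner
    (hCorner : ∀ (W : WeierstrassCurve ℚ) [W.IsElliptic] [W.IsGloballyMinimal] (p : ℕ)
      [Fact p.Prime], ClassX11b W p → ¬ Surj W p → (p = 5 ∨ p = 7) →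
        p ∣ padicValInt p W.minimalDiscriminantInt → ¬ Ram W p → Typed.MissingPPartAt W p)
    (W : WeierstrassCurve ℚ) [W.IsElliptic] [W.IsGloballyMinimal] (p : ℕ) [Fact p.Prime]
    (hX : ClassX11b W p) (hp5 : 5 ≤ p) : BSDp W p := by
  by_cases hsurj : Surj W p
  · by_cases hst : W.HasSplitMultiplicativeReductionAtPrime p →
        ∃ (m : ℕ) (_ : Fact m.Prime), m ≠ p ∧ W.HasMultiplicativeReductionAtPrime m
    · exact P2.bsdp_of_surj_of_regulatorNonvanishing W p hGZ hKo hWu hGZK hmod hnf hHL hMaz hPT hEP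
        hK hJn hJs hHn hHs hD hpar (hA W p) (hReg W p hX hp5) hX hp5 hsurj hst
    · -- split at `p` and no other multiplicative prime: the typed (T2∗) supplies the upper half
      rw [Classical.not_imp] at hst
      exact P2.bsdp_of_surj_of_missingUpperBoundAt_endState W p hGZ hKo hWu hGZK hmod hnf hHL hMaz
        hPT hEP (hA W p) (hUstar W p hX hp5 hst.1 hst.2) hX hp5 hsurj
  · -- the non-surjective corner, localised
    obtain ⟨h57, hdvd, hnram⟩ := ClassX11b.not_surj_shape W p hBDMTV hX hp5 hsurj
    exact Typed.bsdp_of_missingPPartAt W p hGZK (by rw [hX.1]) (hCorner W p hX hsurj h57 hdvd hnram)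

/-- **X11b at `p ≥ 5`, THE TWO ROADS TOGETHER (bookkeeping record).** `∀ (E, p) ∈` X11b,
`p ≥ 5 → BSD(E, p)` from published named facts (route p2's eleven + the lever's seven + Skinner
2016 Thm. A), the per-pair regulator input (REG) `ClassClosure.RegulatorNonvanishingAt W p` at
EVERY pair, and:
* THE open input of route p2 ONLY on the ¬(ram) ∧ surj pairs (112 175 of the 2 267 348 class-wide
  X11b-shape pairs, 4.9 %) — on the (ram) atom (A1 ∪ A2, 2 155 109 pairs) the class-closure lever
  (`ClassClosure.bsdp_of_leverLocus_of_regulatorNonvanishing`: Skinner Thm. A + Jones + Disegni)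
  needs no anticyclotomic input;
* (T2∗) on ¬(ram) ∧ split-at-`p` pairs with no other multiplicative prime (55 089 ‖ 3 326 surjective
  pairs: there the Euler-system half keeps NO source); (T4′) the corner (64 ‖ 5).
So modulo ONE `p`-adic height per pair, the anticyclotomic open input of this route matters exactly
on the ¬(ram) atom. CONDITIONAL; nothing booked; labels UNCHANGED; X11b stays CONSTRUCTION-SHAPED
(REG class-wide = Schneider's conjecture; the open input = FW21 4.41, unrefereed).
[cite: Skinner2016PacificMC, Thm. A (§1), §3.2–3.3] [cite: Wuthrich2014, Thm. 3 (p. 383)]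
[cite: SteinWuthrich2013, Thm. 6.1 (p. 20), §4.2] [cite: Disegni2020, Thm. 1 (§1.2), (∗)]
[cite: Castella2018Erratum, (2.4)] [cite: Miller2011LMS, Def. 1.1] -/
theorem bsdp_of_classX11b_five_twoRoads
    -- route p2's published inputs
    (hGZ : ∀ (N : ℕ) [NeZero N] (W : WeierstrassCurve ℚ) (K : Type) [Field K] [NumberField K],
      gross_zagier N W K)
    (hKo : ∀ (N : ℕ) [NeZero N] (W : WeierstrassCurve ℚ) (K : Type) [Field K] [NumberField K],
      kolyvagin N W K)
    (hWu : sha_dvd_analyticSha)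
    (hGZK : rank_eq_analyticRank_of_analyticRank_le_one) (hmod : hasEntireLFunction_rat)
    (hnf : exists_isNewformOf) (hHL : HoffsteinLuo1997_exists_twist_L_one_ne_zero)
    (hMaz : mazur_not_dvd_maninConstant_of_odd)
    (hBDMTV : thm12_not_le_normalizer_splitCartan)
    (hPT : ∀ (K : Type) [Field K] [NumberField K], poitouTate_sum_localTatePairing_eq_zero K)
    (hEP : ∀ (K : Type) [Field K] [NumberField K] (v : HeightOneSpectrum (𝓞 K)),
      localEulerPoincareCharacteristic (v.adicCompletion K))
    -- the lever's published inputs, and Skinner's Thm. A for the (ram) atom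
    (hSkA : thmA_charIdeal_multiplicative)
    (hK : kato_charIdeal_dvd_multiplicative_of_surjective)
    (hJn : thm61_nonsplitMultiplicative) (hJs : thm61_splitMultiplicative)
    (hHn : exists_isMultCanonical) (hHs : exists_isSplitMultCanonical)
    (hD : thm1_padicBSD_rankOne_multiplicative) (hpar : nonempty_modularParametrizationData)
    -- THE open input of route p2, demanded ONLY on ¬(ram) ∧ surj pairs
    (hA : ∀ (W : WeierstrassCurve ℚ) [W.IsElliptic] [W.IsGloballyMinimal] (p : ℕ) [Fact p.Prime],
      ClassX11b W p → 5 ≤ p → ¬ Ram W p → Surj W p → P2OpenInputOnTreeAt W p)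
    -- (REG) the per-pair regulator input
    (hReg : ∀ (W : WeierstrassCurve ℚ) [W.IsElliptic] [W.IsGloballyMinimal] (p : ℕ) [Fact p.Prime],
      ClassX11b W p → 5 ≤ p → ClassClosure.RegulatorNonvanishingAt W p)
    -- (T2∗)
    (hUstar : ∀ (W : WeierstrassCurve ℚ) [W.IsElliptic] [W.IsGloballyMinimal] (p : ℕ)
      [Fact p.Prime], ClassX11b W p → 5 ≤ p → ¬ Ram W p → W.HasSplitMultiplicativeReductionAtPrime p →
      (¬ ∃ (m : ℕ) (_ : Fact m.Prime), m ≠ p ∧ W.HasMultiplicativeReductionAtPrime m) →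
      Typed.MissingUpperBoundAt W p)
    -- (T4′)
    (hCorner : ∀ (W : WeierstrassCurve ℚ) [W.IsElliptic] [W.IsGloballyMinimal] (p : ℕ)
      [Fact p.Prime], ClassX11b W p → ¬ Surj W p → (p = 5 ∨ p = 7) →
        p ∣ padicValInt p W.minimalDiscriminantInt → ¬ Ram W p → Typed.MissingPPartAt W p)
    (W : WeierstrassCurve ℚ) [W.IsElliptic] [W.IsGloballyMinimal] (p : ℕ) [Fact p.Prime]
    (hX : ClassX11b W p) (hp5 : 5 ≤ p) : BSDp W p := by
  by_cases hram : Ram W p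
  · -- the (ram) atom: the class-closure lever, no anticyclotomic input
    exact ClassClosure.bsdp_of_leverLocus_of_regulatorNonvanishing W p hSkA hJn hJs hHn hHs hD hGZK
      hpar hX (ClassClosure.leverLocusAt_of_ram_of_five_le W p hram hp5) (hReg W p hX hp5)
  · by_cases hsurj : Surj W p
    · by_cases hst : W.HasSplitMultiplicativeReductionAtPrime p →
          ∃ (m : ℕ) (_ : Fact m.Prime), m ≠ p ∧ W.HasMultiplicativeReductionAtPrime m
      · exact P2.bsdp_of_surj_of_regulatorNonvanishing W p hGZ hKo hWu hGZK hmod hnf hHL hMaz hPT hEP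
          hK hJn hJs hHn hHs hD hpar (hA W p hX hp5 hram hsurj) (hReg W p hX hp5) hX hp5 hsurj hst
      · rw [Classical.not_imp] at hst
        exact P2.bsdp_of_surj_of_missingUpperBoundAt_endState W p hGZ hKo hWu hGZK hmod hnf hHL hMaz
          hPT hEP (hA W p hX hp5 hram hsurj) (hUstar W p hX hp5 hram hst.1 hst.2) hX hp5 hsurj
    · obtain ⟨h57, hdvd, hnram⟩ := ClassX11b.not_surj_shape W p hBDMTV hX hp5 hsurj
      exact Typed.bsdp_of_missingPPartAt W p hGZK (by rw [hX.1]) (hCorner W p hX hsurj h57 hdvd hnram)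

end Summit.BirchSwinnertonDyer.Rank1Residual.X11b

end
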